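import Literature.NumberTheory.EllipticCurves.Kato2004.EulerSystemTatePairingValuesTwoProofs
import Literature.NumberTheory.EllipticCurves.Kato2004.EulerSystemDefinedValues
import HarnessLib

/-!
# Kato 2004 Thm. 12.5 (1) read on the layer Tate pairing at `p = 2` — the fact
# `exists_eulerSystem_expStar_tatePairing_values_two` from THREE displayed print statements in the tree's vocabulary:
# Kato's matrix for the DEFINED dual exponential at the standard complex frame (`DefinedExpStarBody`), the layer
# Tate-pairing law for that value datum up to a rational unit (Rubin 1998 §5 (1)–(2) / Kobayashi 2003 (8.29) / Bloch–Kato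
# 1990 Ex. 3.10.1–3.11), and the irreducibility of `E[2]` at a good supersingular `2` (Serre 1972 Prop. 12)

`Proofs`-style companion of `EulerSystemTatePairingValuesTwo.lean` / `EulerSystemTatePairingValuesTwoProofs.lean` (THEOREMS
ONLY: no definition, no named fact, no instance, no notation, no `sorry`).  Seat `bsd-input-kato-es-two` g0
(literature-prover, cell `pub/bsd-wall/bsd-inputs`, «inputs → unconditional», `--supports stmt-BirchSwinnertonDyer-22680`,
helper).  Kept in its own module because it imports the `p`-adic Hodge theory tower of `EulerSystemDefinedValues.lean`
(`bdRPeriodRingData`, `dualExpCoord`), which the light companion does not need.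

HONEST FRAMING: the three hypotheses are DISPLAYED, not proved; the first two are Kato's theorem with Bloch–Kato's `exp*` and the
explicit local description of `exp*` by the formal logarithm (published inputs, sizes XL / L), the third is a Summits-side theorem
of the tree (`Summit.BirchSwinnertonDyer.Rank1Residual.P2.irr_two_of_goodSS_two`, not importable into `Literature/`).  Nothing here
proves `F := exists_eulerSystem_expStar_tatePairing_values_two`; no `_holds`; no item closed; no summit statement
(`BirchSwinnertonDyer`) is proved or advanced by this file.

## The theorem

`exists_eulerSystem_expStar_tatePairing_values_two_of_definedExpStarBody (hK) (hB) (hIrr) : F`, where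
* `hK` — **Kato 2004 with `exp*` DEFINED, at the STANDARD complex frame, `p = 2`**: for every elliptic `W/ℚ` with `W[2]`
  irreducible, its newform `f`, and every complex embedding family `ιC` with `ιC(ζ_{2^k}) = e^{2πi/2^k}` at the pure `2`-power
  levels: `∃ d κK Λ, κK ≠ 0 ∧ DefinedExpStarBody W 2 f d ιC κK Λ` — the matrix of the tree's named fact
  `exists_eulerSystem_definedExpStar_values` (Kato (8.1.3)/Ex. 13.3, Prop. 8.12, §9.4 + §11.3, Thm. 9.7, Thm. 6.6 (1), Thm. 12.5 (1)
  [Kato2004Asterisque pp. 180, 225, 186, 188, 189, 163, 221–222]) with its EXISTENTIAL frame `ι` replaced by the standard one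
  (Kato (5.7.1) p. 157: `ζ_N = e^{2πi/N}`; Rubin 1998 Thm. 7.1).  That named fact does NOT imply `hK` as typed (∃ι versus pinned ι:
  `G9-LEAD-AUDIT.md` §1 of crux `SignedKatoDivisibilityUpToAtTwo`); `hK` is print, the fact is weaker than print on this axis.
* `hB` — **the layer Tate-pairing law for the DEFINED value datum, up to a rational unit**: for every datum of `F` (place
  `v ∣ 2`, `W`, `κ`, `f`, continuous `2`-adic frame `(Φ, φ)`, coherent tower `e` with lifts `τ`) and every `(d, ι, κK, Λ)` with
  `DefinedExpStarBody W 2 f d ι κK Λ`, there is `u ∈ ℚˣ` such that for every layer `n`, class `y ∈ H¹(ℚ(μ_{2^{n+2}}), T₂W)` and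
  formal layer point `Q₀`: `⟨Cor y, Q₀⟩_n = u · Σ_b τ_{n+2}(b) (log_{W⊗ℚ₂}(z(Q₀)) · ẽ_{n+2}(Λ y))` (clause (C6˟) of the companion
  file).  PRINT: Rubin 1998 §5 displays (1)–(2) «`z` corresponds to `x ↦ Tr_{ℚ_{n,p}/ℚ_p} λ_E(x) exp*_{ω_E}(z)`», Kobayashi 2003
  (8.29) p. 24 «`(x, z)_n = Tr_{k_n/ℚ_p} log_Ê(x) exp*_{ω_E}(z)` … `( , )_n` is the Tate pairing», Bloch–Kato 1990 Def. 3.10 /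
  Ex. 3.10.1 pp. 359–360 («the exponential map (3.10) coincides with the classical one») and Ex. 3.11 (3.11.1) p. 361, Kato LNM
  1553 II Thm. 1.4.1 (4) with Lemma 1.4.3–1.4.5 (`exp*` as the transpose of `exp` under Tate duality, trace formula), composed
  with the projection formula for corestriction [NSW (1.5.3) (iv)] and `Tr_{ℚ₂(μ_{2^{n+2}})/ℚ₂} = Σ_b τ_b`.  The unit: `exp*_d =
  λ⁻¹ exp*_ω` for `d = λ[ω_W]` (scale law `dualExpCoord_smul` of `NeronDeRhamDatum.lean`); `u ∈ ℚˣ` (not merely `ℚ₂ˣ`) is where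
  the Néron normalisation enters — print has `ω_E` itself (Rubin Thm. 7.1: `r_E ∈ ℤ_{>0}`), the tree only a scale-free
  generator `d` (road (A) of `NeronDeRhamDatum.lean`, the canonical class `t_ω`, is a recorded TODO there); for the `d` of `hK`
  rationality of `λ` follows from the rationality (C4) of one non-zero value (`ℚ₂ ∩ ℚ(ζ_{2^k}) = ℚ`).  Recorded, not asserted.
* `hIrr` — `GoodSS W 2 → W.HasIrreducibleModPGaloisRep 2` for globally minimal `W` (Serre 1972 §1.11 Prop. 12 at `p = 2`: inertia
  acts on `E[2] ∖ 0` through a cyclic group of order `3`, transitively).  A THEOREM of the tree Summits-side; displayed here because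
  `Literature/` cannot import `Summits/`.
PROOF: `hIrr` feeds `hK`; `hB` at the datum of `hK`; then `exists_eulerSystem_expStar_tatePairing_values_two_of_pairingLaw_upTo`.

## References

* K. Kato, Astérisque 295 (2004): (5.7.1) p. 157, Thm. 6.6 (1) p. 163, (8.1.3) p. 180, Prop. 8.12 p. 186, §9.4 p. 188, Thm. 9.7
  p. 189, Thm. 12.5 (1) pp. 221–222, Ex. 13.3 p. 225. [Kato2004Asterisque]
* K. Rubin, *Euler systems and modular elliptic curves*, LMS LN 254 (1998), §5 (1)–(2), Thm. 7.1, Cor. 7.2. [Rubin1998Durham]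
* S. Kobayashi, Invent. math. 152 (2003), (8.23) p. 18, (8.28)–(8.29), Prop. 8.25 p. 24. [Kobayashi2003]
* S. Bloch, K. Kato (1990), Prop. 3.8 p. 354, Def. 3.10, Ex. 3.10.1 pp. 359–360, Ex. 3.11 p. 361. [BlochKato1990]
* K. Kato, LNM 1553 (1993), Ch. II §1.2.4, Thm. 1.4.1 (4), Lemma 1.4.3–1.4.5. [Kato1993LNM1553]
* J.-P. Serre, Invent. Math. 15 (1972), §1.11 Prop. 12. [Serre1972]
* J. Neukirch, A. Schmidt, K. Wingberg, *Cohomology of Number Fields*, (1.5.3) (iv). [NeukirchSchmidtWingberg2008]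
* Tree: `Kato2004/EulerSystemDefinedValues.lean` (`DefinedExpStarBody`, `exists_eulerSystem_definedExpStar_values`),
  `Kato2004/EulerSystemTatePairingValuesTwoProofs.lean` (`…_of_pairingLaw_upTo`), `PAdicHodge/NeronDeRhamDatum.lean`,
  `PAdicHodge/DualExpElliptic.lean`; Summits-side `Summits/BirchSwinnertonDyer/Rank1Residual/P2/EmptyCellsAtTwo.lean`
  (`irr_two_of_goodSS_two`), `Summits/…/Cruxes/SignedKatoDivisibilityUpToAtTwo/G9-LEAD-AUDIT.md` §1, §4.
-/

noncomputable section

open scoped Classical NumberField TensorProduct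
open Field IsDedekindDomain CongruenceSubgroup NumberField WeierstrassCurve
open Literature.NumberTheory.GaloisRepresentations
open Literature.NumberTheory.EllipticCurves Literature.NumberTheory.EllipticCurves.ModularForms
open Literature.NumberTheory.EllipticCurves.Rank1Residual Literature.NumberTheory.EllipticCurves.Kobayashi2003
open Literature.NumberTheory.EllipticCurves.Kato2004.EulerSystemValues
open ZpExtension

namespace Literature.NumberTheory.EllipticCurves.Kato2004

set_option backward.isDefEq.respectTransparency false in
/-- **Kato 2004 Thm. 12.5 (1) read on the layer Tate pairing at `2`, from three displayed print statements.**  IF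
(`hK`) Kato's matrix with the DEFINED dual exponential holds at the standard complex frame for every `W/ℚ` with `W[2]`
irreducible — `∃ d κK Λ, κK ≠ 0 ∧ DefinedExpStarBody W 2 f d ιC κK Λ` [Kato 2004 (8.1.3), Prop. 8.12, §9.4, Thm. 9.7,
Thm. 6.6 (1), Ex. 13.3, Thm. 12.5 (1), frame (5.7.1); Rubin 1998 Thm. 7.1] — and (`hB`) every such value datum `Λ` is read on
the `T₂W`-adic layer Tate pairings of the cyclotomic `ℤ₂`-tower against formal points by
`⟨Cor y, Q₀⟩_n = u · Σ_b τ_{n+2}(b) (log_{W⊗ℚ₂}(z(Q₀)) · ẽ_{n+2}(Λ y))` for one rational `u ≠ 0` [Rubin 1998 §5 (1)–(2);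
Kobayashi 2003 (8.29); Bloch–Kato 1990 Ex. 3.10.1, (3.11.1); Kato LNM 1553 II Thm. 1.4.1 (4)] — and (`hIrr`) `E[2]` is
irreducible at a good supersingular `2` [Serre 1972 Prop. 12; a Summits-side theorem of the tree], THEN
`exists_eulerSystem_expStar_tatePairing_values_two`.  A reduction: the hypotheses are displayed, not proved; `F` is NOT
proved here. [cite: Kato2004Asterisque, Thm. 12.5 (1) (pp. 221–222), Thm. 9.7 (p. 189), Thm. 6.6 (1) (p. 163), (5.7.1) (p. 157)]
[cite: Rubin1998Durham, §5 displays (1)–(2) and Thm. 7.1] [cite: Kobayashi2003, (8.23) (p. 18), (8.28)–(8.29) and Prop. 8.25 (p. 24)]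
[cite: BlochKato1990, Def. 3.10 and Ex. 3.10.1 (pp. 359–360), Ex. 3.11 (p. 361)] [cite: Serre1972, §1.11 Prop. 12] -/
theorem exists_eulerSystem_expStar_tatePairing_values_two_of_definedExpStarBody
    (hK : ∀ (W : WeierstrassCurve ℚ) [W.IsElliptic]
      [ContinuousSMul ℤ_[2] (W.tateModule 2)] [Module.Free ℤ_[2] (W.tateModule 2)] [Module.Finite ℤ_[2] (W.tateModule 2)],
      W.HasIrreducibleModPGaloisRep 2 →
      ∀ {N : ℕ} [NeZero N] (f : CuspForm (Gamma0 N) 2), IsNewformOf W f →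
      ∀ (ιC : (m : ℕ) → (CyclotomicField m ℚ →+* ℂ)),
      (∀ k : ℕ, ιC (cycLevel 2 k ∅) (IsCyclotomicExtension.zeta (cycLevel 2 k ∅) ℚ (CyclotomicField (cycLevel 2 k ∅) ℚ)) =
        Complex.exp (2 * Real.pi * Complex.I / (cycLevel 2 k ∅ : ℕ))) →
      ∃ d κK Λ, κK ≠ 0 ∧ DefinedExpStarBody W 2 f d ιC κK Λ)
    (hB : ∀ (v : HeightOneSpectrum (𝓞 ℚ)), ((2 : ℕ) : 𝓞 ℚ) ∈ v.asIdeal →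
      ∀ (W : WeierstrassCurve ℚ) [W.IsElliptic] [W.IsGloballyMinimal], GoodSS W 2 →
      ∀ (κ : ZpExtension ℚ 2) (hκ : κ.IsCyclotomic),
      ∀ [NeZero (W.conductorNorm ℤ)] (f : CuspForm (Gamma0 (W.conductorNorm ℤ)) 2), IsNewformOf W f →
      ∀ [ContinuousSMul ℤ_[2] (W.tateModule 2)] [Module.Free ℤ_[2] (W.tateModule 2)]
        [Module.Finite ℤ_[2] (W.tateModule 2)],
      ∀ (Φ : AlgebraicClosure ℚ_[2] ≃ₐ[ℚ] AlgebraicClosure (v.adicCompletion ℚ)) (φ : ℚ_[2] ≃+* v.adicCompletion ℚ),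
        (∀ y : ℚ_[2], Φ (algebraMap ℚ_[2] (AlgebraicClosure ℚ_[2]) y) =
          algebraMap (v.adicCompletion ℚ) (AlgebraicClosure (v.adicCompletion ℚ)) (φ y)) →
      ∀ (e : ∀ k : ℕ, CyclotomicField (cycLevel 2 k ∅) ℚ →ₐ[ℚ] PadicAlgCl 2)
        (τ : ∀ m : ℕ, ZMod (2 ^ m) → Field.absoluteGaloisGroup ℚ_[2]),
        (∀ k : ℕ, e (k + 1) (IsCyclotomicExtension.zeta (cycLevel 2 (k + 1) ∅) ℚ (CyclotomicField (cycLevel 2 (k + 1) ∅) ℚ)) ^ 2 =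
          e k (IsCyclotomicExtension.zeta (cycLevel 2 k ∅) ℚ (CyclotomicField (cycLevel 2 k ∅) ℚ))) →
        (∀ (k : ℕ) (a : ZMod (2 ^ k)), IsUnit a →
          τ k a • e k (IsCyclotomicExtension.zeta (cycLevel 2 k ∅) ℚ (CyclotomicField (cycLevel 2 k ∅) ℚ)) =
            e k (IsCyclotomicExtension.zeta (cycLevel 2 k ∅) ℚ (CyclotomicField (cycLevel 2 k ∅) ℚ)) ^ a.val) →
      ∀ d (ι : (m : ℕ) → (CyclotomicField m ℚ →+* ℂ)) (κK : ℝ)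
        (Λ : ∀ (k : ℕ) (r : Finset (HeightOneSpectrum (𝓞 ℚ))),
          H1 (tateRep W 2) (cycSubgroup 2 k r) →ₗ[ℤ_[2]] ℚ_[2] ⊗[ℚ] CyclotomicField (cycLevel 2 k r) ℚ),
        DefinedExpStarBody W 2 f d ι κK Λ →
      ∃ u : ℚ, u ≠ 0 ∧
        ∀ (n : ℕ) (y : H1 (tateRep W 2) (cycSubgroup 2 (n + 2) ∅)) (Q₀ : localPoints W ℚ_[2])
            (hQv : WeierstrassCurve.Affine.Point.map (W' := W)
                (Φ : AlgebraicClosure ℚ_[2] →ₐ[ℚ] AlgebraicClosure (v.adicCompletion ℚ))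
                (show (W.baseChange (AlgebraicClosure ℚ_[2])).toAffine.Point from Q₀) ∈
              localLayerPointsOfEmb κ (closureEmb (K := ℚ) (v.adicCompletion ℚ)) W n),
            (∀ (X Y : AlgebraicClosure ℚ_[2]) (hXY : (W.baseChange (AlgebraicClosure ℚ_[2])).toAffine.Nonsingular X Y),
                (show (W.baseChange (AlgebraicClosure ℚ_[2])).toAffine.Point from Q₀) = .some X Y hXY → 1 < Valued.v X) →
            ∃ t : ℤ_[2],
              (∀ k : ℕ, CyclotomicLayer.tatePairingPk W κ v n k
                  (levelToLayerTwo W hκ (∅ : Set (HeightOneSpectrum (𝓞 ℚ))) n y) ⟨_, hQv⟩ = PadicInt.toZModPow k t) ∧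
              algebraMap ℚ_[2] (PadicAlgCl 2) (t : ℚ_[2]) =
                (u : PadicAlgCl 2) *
                  ∑ b : (ZMod (2 ^ (n + 2)))ˣ, τ (n + 2) (b : ZMod (2 ^ (n + 2))) •
                    ((∑' i : ℕ, algebraMap ℚ_[2] (PadicAlgCl 2) (PowerSeries.coeff i (W.map (algebraMap ℚ ℚ_[2])).formalLog) *
                        (WeierstrassCurve.Affine.Point.zCoord
                          (show (W.baseChange (AlgebraicClosure ℚ_[2])).toAffine.Point from Q₀)) ^ i) *
                      Algebra.TensorProduct.lift (algebraMap ℚ_[2] (PadicAlgCl 2)).toRatAlgHom (e (n + 2))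
                        (fun _ _ ↦ Commute.all _ _) (Λ (n + 2) ∅ y)))
    (hIrr : ∀ (W : WeierstrassCurve ℚ) [W.IsElliptic] [W.IsGloballyMinimal], GoodSS W 2 → W.HasIrreducibleModPGaloisRep 2) :
    exists_eulerSystem_expStar_tatePairing_values_two := by
  refine exists_eulerSystem_expStar_tatePairing_values_two_of_pairingLaw_upTo ?_
  intro v hv W _ _ hss κ hκ _ f hf _ _ _ Φ φ hΦφ e τ he hτ ιC hιC
  obtain ⟨d, κK, Λ, hκK, hbody⟩ := hK W (hIrr W hss) f hf ιC hιC
  obtain ⟨u, hu, hC6⟩ := hB v hv W hss κ hκ f hf Φ φ hΦφ e τ he hτ d ιC κK Λ hbody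
  exact ⟨κK, hκK, Λ, u, hu, hC6, hbody.2⟩

end Literature.NumberTheory.EllipticCurves.Kato2004

end
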